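import Summits.Ventures.PercRepro.GenQRuleA
import Summits.Ventures.PercRepro.GenQDichotomy
import Summits.Ventures.PercRepro.TheoremNAll

/-!
# PercRepro — C-025 at `(q + 2, q)`: the hard max-trace rule at EVERY `q`, part B — supply, demand, the per-flat
transfer and the core of the row from the per-flat balance (night-4, gen 0; part A = `GenQRuleA.lean`)

p3's `SixFourRule.lean` / `SixFourFrame.lean` (core half) at every `q`, on the rule `fHardQ` / `DHardQ` and the
single-witness share `w_∞(B) ≤ fHardQ G (B ∪ {x}) / DHardQ (B ∪ {x})` of part A:

* SUPPLY — summing the single-point witnesses over the injective family `(B, x) ↦ B ∪ {x}` on `R_q(G) × (E ∖ G)`: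
  `|E ∖ G| · Σ_{B ∈ R_q(G)} w_∞(B) ≤ Σ_{S ∈ Y} fHardQ G S / DHardQ S` (`supply_single_ge_q`);
* DEMAND — with the TYPE `t = typeOfQ M q G = (q + 2) − ρ(E ∖ G)` (truncated at `0`): a bottom set `B ⊆ G` has
  `ρ(G ∖ B) ≥ t` (`q + 2 = ρ(E ∖ B) ≤ ρ(E ∖ G) + ρ(G ∖ B)`), so it is not demand-free: `#U_G + DF_t ≤ N_q`
  (`card_UqG_add_DFq_le`);
* TRANSFER — `perFlat_of_Jq_nonneg`: `0 ≤ Jq M G q t` at `t = typeOfQ M q G` gives the per-flat inequality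
  `((q + 2)/(q + 1)) · #U_G ≤ Σ_{S ∈ Y} fHardQ G S / Σ_{G'} fHardQ G' S` of `PerFlat.c025_of_perFlat_normalized`;
* **`rls_succ_succ_of_perFlatAll`** — THE CORE OF THE `(q + 2, q)` ROW FROM THE PER-FLAT BALANCE: on a simple
  matroid of rank `≥ q + 2` (so every rank-`q` flat has type `≤ q`, `typeOfQ_le_q`), `PerFlatAll q`
  (`GenQDichotomy.lean`) gives `RLS M (q + 2) q`, i.e. `((q + 2)/(q + 1)) · #U(q + 2, q) ≤ #Y(q + 2, q)`;
* **`rls_succ_succ_of_residue`** — the same from the balance on the family `𝔉` alone (`PerFlatResidue q`, via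
  `perFlatAll_of_residue`): the core of every `(q + 2, q)` row is reduced to the general analogue of the `(6, 4)`
  residue of record.

At `q = 4` this is `perSolid_of_J_nonneg` / `rls_six_four_of_perSolid` on the core.  What is NOT here: the
`|E|`-induction from the core to every finite matroid (night-1's `RankLevelSetFrameQ.lean`, the general form of
`SixFourFrame.lean`: loops halve, a parallel pair is Theorem F with `(q + 1, q − 1)` on `M ／ e`, a coloop at
rank `q + 2` is the two injections, `ρ(E) < q + 2` is empty).
-/

open scoped Matroid

namespace PercRepro.GenQ

open Finset ThmH PerFlat ThmN SixFour

variable {α : Type*} [DecidableEq α] {M : Matroid α} [M.Finite]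

/-! ## The supply of a rank-`q` flat -/

/-- **Supply from the single-point witnesses**: `|E ∖ G| · Σ_{B ∈ R_q(G)} w_∞(B) ≤ Σ_{S ∈ Y} fHardQ G S / DHardQ S`. -/
theorem supply_single_ge_q {G : Finset α} {q : ℕ} (hG : G ∈ flatsQ M q) :
    ((gr M \ G).card : ℚ) * ∑ B ∈ Rq M G q, wInf M B ≤
      ∑ S ∈ Yq M (q + 2) q, fHardQ M q G S / DHardQ M q S := by
  have hGg : G ⊆ gr M := (mem_flatsQ.1 hG).1
  have hmaps : ∀ p ∈ Rq M G q ×ˢ (gr M \ G), insert p.2 p.1 ∈ Yq M (q + 2) q := by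
    intro p hp
    rw [Finset.mem_product] at hp
    obtain ⟨hB, hx⟩ := hp
    rw [mem_Rq] at hB
    rw [Finset.mem_sdiff] at hx
    rw [mem_Yq_succ_succ]
    refine ⟨Finset.insert_subset hx.1 (hB.1.trans hGg), ?_⟩
    rw [eRk_insert_eq_succ_q hG hB.1 hB.2 hx.1 hx.2]
    constructor
    · exact_mod_cast Nat.lt_succ_self q
    · exact_mod_cast (by omega : q + 1 < q + 2)
  have hinj : Set.InjOn (fun p : Finset α × α => insert p.2 p.1)
      ((Rq M G q ×ˢ (gr M \ G) : Finset (Finset α × α)) : Set (Finset α × α)) := by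
    intro p hp q' hq hpq
    rw [Finset.mem_coe, Finset.mem_product] at hp hq
    simp only at hpq
    obtain ⟨hpB, hpx⟩ := hp
    obtain ⟨hqB, hqx⟩ := hq
    rw [mem_Rq] at hpB hqB
    rw [Finset.mem_sdiff] at hpx hqx
    have h1 : p.1 = q'.1 := by
      rw [← insert_inter_eq_q hpB.1 hpx.2, ← insert_inter_eq_q hqB.1 hqx.2, hpq]
    have h2 : p.2 = q'.2 := by
      have hx : p.2 ∈ insert q'.2 q'.1 := by
        rw [← hpq]
        exact Finset.mem_insert_self _ _
      rcases Finset.mem_insert.1 hx with h | h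
      · exact h
      · exact absurd (hqB.1 h) hpx.2
    exact Prod.ext h1 h2
  calc ((gr M \ G).card : ℚ) * ∑ B ∈ Rq M G q, wInf M B
      = ∑ B ∈ Rq M G q, ∑ _x ∈ gr M \ G, wInf M B := by
        rw [Finset.mul_sum]
        refine Finset.sum_congr rfl (fun B _ => ?_)
        rw [Finset.sum_const, nsmul_eq_mul]
    _ = ∑ p ∈ Rq M G q ×ˢ (gr M \ G), wInf M p.1 := by
        rw [Finset.sum_product]
    _ ≤ ∑ p ∈ Rq M G q ×ˢ (gr M \ G), fHardQ M q G (insert p.2 p.1) / DHardQ M q (insert p.2 p.1) := by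
        apply Finset.sum_le_sum
        intro p hp
        rw [Finset.mem_product] at hp
        obtain ⟨hB, hx⟩ := hp
        rw [mem_Rq] at hB
        rw [Finset.mem_sdiff] at hx
        exact share_single_ge_q hG hB.1 hB.2 hx.1 hx.2
    _ = ∑ S ∈ (Rq M G q ×ˢ (gr M \ G)).image (fun p : Finset α × α => insert p.2 p.1),
          fHardQ M q G S / DHardQ M q S := by
        rw [Finset.sum_image hinj]
    _ ≤ ∑ S ∈ Yq M (q + 2) q, fHardQ M q G S / DHardQ M q S := by
        apply Finset.sum_le_sum_of_subset_of_nonneg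
        · intro S hS
          rw [Finset.mem_image] at hS
          obtain ⟨p, hp, rfl⟩ := hS
          exact hmaps p hp
        · intro S _ _
          exact div_nonneg (fHardQ_nonneg q G S) (DHardQ_nonneg q S)

/-! ## The type of a rank-`q` flat and the demand -/

/-- The TYPE of `G` at level `q`: `t = (q + 2) − ρ(E ∖ G)`, truncated at `0` (mine-2 §23.1 (F)). -/
noncomputable def typeOfQ (M : Matroid α) [M.Finite] (q : ℕ) (G : Finset α) : ℕ :=
  (q + 2) - (M.eRk ((gr M \ G : Finset α) : Set α)).toNat

/-- `t ≤ q + 2`. -/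
theorem typeOfQ_le (q : ℕ) (G : Finset α) : typeOfQ M q G ≤ q + 2 := Nat.sub_le _ _

/-- `(q + 2) − t ≤ |E ∖ G|` (through `(q + 2) − t ≤ ρ(E ∖ G) ≤ |E ∖ G|`). -/
theorem sub_typeOfQ_le_card (q : ℕ) (G : Finset α) : (q + 2) - typeOfQ M q G ≤ (gr M \ G).card := by
  obtain ⟨r, hr, hrle⟩ := eRk_eq_nat M (gr M \ G)
  unfold typeOfQ
  rw [hr, ENat.toNat_coe]
  omega

/-- **Demand**: a bottom set `B` of the flat `G` has `ρ(G ∖ B) ≥ t`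
(`q + 2 = ρ(E ∖ B) ≤ ρ(E ∖ G) + ρ(G ∖ B)`). -/
theorem typeOfQ_le_eRk_sdiff {G B : Finset α} {q : ℕ} (hB : B ∈ UqG M (q + 2) q G) :
    (typeOfQ M q G : ℕ∞) ≤ M.eRk ((G \ B : Finset α) : Set α) := by
  obtain ⟨⟨-, -, h6⟩, -⟩ := mem_UqG_succ_succ.1 hB
  have hsub : gr M \ B ⊆ (gr M \ G) ∪ (G \ B) := by
    intro y hy
    rw [Finset.mem_sdiff] at hy
    rw [Finset.mem_union, Finset.mem_sdiff, Finset.mem_sdiff]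
    by_cases hyG : y ∈ G
    · exact Or.inr ⟨hyG, hy.2⟩
    · exact Or.inl ⟨hy.1, hyG⟩
  have h := M.eRk_union_le_eRk_add_eRk ((gr M \ G : Finset α) : Set α) ((G \ B : Finset α) : Set α)
  rw [← Finset.coe_union] at h
  have h' := (M.eRk_mono (Finset.coe_subset.2 hsub)).trans h
  rw [h6] at h'
  obtain ⟨r, hr, -⟩ := eRk_eq_nat M (gr M \ G)
  obtain ⟨k, hk, -⟩ := eRk_eq_nat M (G \ B)
  rw [hr, hk] at h'
  rw [hk]
  unfold typeOfQ
  rw [hr, ENat.toNat_coe]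
  have h6' : ((q + 2 : ℕ) : ℕ∞) ≤ ((r + k : ℕ) : ℕ∞) := by
    push_cast
    exact h'
  have h6'' := (Nat.cast_le (α := ℕ∞)).1 h6'
  exact_mod_cast (by omega : q + 2 - r ≤ k)

/-- **`#U_G + DF_t ≤ N_q` at `t = typeOfQ M q G`**: the bottom sets and the demand-free sets are disjoint
subfamilies of `R_q(G)`. -/
theorem card_UqG_add_DFq_le (q : ℕ) (G : Finset α) :
    (UqG M (q + 2) q G).card + DFq M G q (typeOfQ M q G) ≤ Nq M G q := by
  classical
  unfold DFq Nq
  rw [← Finset.card_union_of_disjoint]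
  · apply Finset.card_le_card
    apply Finset.union_subset
    · intro B hB
      obtain ⟨⟨-, hr, -⟩, hBG⟩ := mem_UqG_succ_succ.1 hB
      exact mem_Rq.2 ⟨hBG, hr⟩
    · exact Finset.filter_subset _ _
  · rw [Finset.disjoint_left]
    intro B hB hB'
    rw [Finset.mem_filter] at hB'
    have h1 := typeOfQ_le_eRk_sdiff hB
    have h2 := hB'.2
    obtain ⟨k, hk, -⟩ := eRk_eq_nat M (G \ B)
    rw [hk] at h1 h2
    have h1' : typeOfQ M q G ≤ k := by exact_mod_cast h1
    have h2' : ((k + 1 : ℕ) : ℕ∞) ≤ (typeOfQ M q G : ℕ∞) := by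
      push_cast
      exact h2
    have h2'' := (Nat.cast_le (α := ℕ∞)).1 h2'
    omega

/-! ## The per-flat transfer and the core of the row -/

/-- **The per-flat inequality from the balance `Jq ≥ 0`**: for a rank-`q` flat `G` of type `t = typeOfQ M q G`,
`0 ≤ Jq M G q t` gives `((q + 2)/(q + 1)) · #U_G ≤ Σ_{S ∈ Y(q+2, q)} fHardQ G S / Σ_{G'} fHardQ G' S` — the
hypothesis `hflat` of `PerFlat.c025_of_perFlat_normalized` at `(q + 2, q)` with the hard max-trace rule. -/
theorem perFlat_of_Jq_nonneg {G : Finset α} {q : ℕ} (hG : G ∈ flatsQ M q)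
    (hJ : 0 ≤ Jq M G q (typeOfQ M q G)) :
    (((q : ℚ) + 2) / ((q : ℚ) + 1)) * ((UqG M (q + 2) q G).card : ℚ) ≤
      ∑ S ∈ Yq M (q + 2) q, fHardQ M q G S / ∑ G' ∈ flatsQ M q, fHardQ M q G' S := by
  have hgoal : (∑ S ∈ Yq M (q + 2) q, fHardQ M q G S / ∑ G' ∈ flatsQ M q, fHardQ M q G' S) =
      ∑ S ∈ Yq M (q + 2) q, fHardQ M q G S / DHardQ M q S := rfl
  rw [hgoal]
  have hsupply := supply_single_ge_q hG
  have hdemand := card_UqG_add_DFq_le (M := M) q G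
  have hW := sub_typeOfQ_le_card (M := M) q G
  have hsum : 0 ≤ ∑ B ∈ Rq M G q, wInf M B := Finset.sum_nonneg (fun B _ => (wInf_pos B).le)
  have hJ' : (((q : ℚ) + 2) / ((q : ℚ) + 1)) * ((Nq M G q : ℚ) - (DFq M G q (typeOfQ M q G) : ℚ)) ≤
      ((q : ℚ) + 2 - (typeOfQ M q G : ℚ)) * ∑ B ∈ Rq M G q, wInf M B := by
    unfold Jq at hJ
    rw [← Finset.mul_sum] at hJ
    linarith
  have hW' : (q : ℚ) + 2 - (typeOfQ M q G : ℚ) ≤ ((gr M \ G).card : ℚ) := by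
    have h := (Nat.cast_le (α := ℚ)).2 hW
    rw [Nat.cast_sub (typeOfQ_le (M := M) q G)] at h
    push_cast at h
    linarith
  have hd : ((UqG M (q + 2) q G).card : ℚ) ≤ (Nq M G q : ℚ) - (DFq M G q (typeOfQ M q G) : ℚ) := by
    have h : (((UqG M (q + 2) q G).card + DFq M G q (typeOfQ M q G) : ℕ) : ℚ) ≤ (Nq M G q : ℚ) := by
      exact_mod_cast hdemand
    rw [Nat.cast_add] at h
    linarith
  have hΦ : (0 : ℚ) ≤ ((q : ℚ) + 2) / ((q : ℚ) + 1) := by positivity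
  calc (((q : ℚ) + 2) / ((q : ℚ) + 1)) * ((UqG M (q + 2) q G).card : ℚ)
      ≤ (((q : ℚ) + 2) / ((q : ℚ) + 1)) * ((Nq M G q : ℚ) - (DFq M G q (typeOfQ M q G) : ℚ)) :=
        mul_le_mul_of_nonneg_left hd hΦ
    _ ≤ ((q : ℚ) + 2 - (typeOfQ M q G : ℚ)) * ∑ B ∈ Rq M G q, wInf M B := hJ'
    _ ≤ ((gr M \ G).card : ℚ) * ∑ B ∈ Rq M G q, wInf M B := mul_le_mul_of_nonneg_right hW' hsum
    _ ≤ ∑ S ∈ Yq M (q + 2) q, fHardQ M q G S / DHardQ M q S := hsupply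

/-- A rank-`q` flat of a matroid of rank `≥ q + 2` has type `≤ q`
(`q + 2 ≤ ρ(E) ≤ ρ(G) + ρ(E ∖ G) = q + ρ(E ∖ G)`). -/
theorem typeOfQ_le_q {G : Finset α} {q : ℕ} (hG : G ∈ flatsQ M q) (hge : ((q + 2 : ℕ) : ℕ∞) ≤ M.eRank) :
    typeOfQ M q G ≤ q := by
  have hGg : G ⊆ gr M := (mem_flatsQ.1 hG).1
  have hr : M.eRk (G : Set α) = (q : ℕ∞) := (mem_flatsQ.1 hG).2.2
  unfold typeOfQ
  obtain ⟨r, hr', -⟩ := eRk_eq_nat M (gr M \ G)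
  rw [hr', ENat.toNat_coe]
  have hE : G ∪ (gr M \ G) = gr M := Finset.union_sdiff_of_subset hGg
  have h := M.eRk_union_le_eRk_add_eRk (G : Set α) ((gr M \ G : Finset α) : Set α)
  rw [← Finset.coe_union, hE, coe_gr, M.eRk_ground, hr, hr'] at h
  have h' := hge.trans h
  have h'' : ((q + 2 : ℕ) : ℕ∞) ≤ ((q + r : ℕ) : ℕ∞) := by
    push_cast
    exact h'
  have := (Nat.cast_le (α := ℕ∞)).1 h''
  omega

/-- **The core of the `(q + 2, q)` row from the per-flat balance**: on a simple matroid of rank `≥ q + 2`,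
`PerFlatAll q` — the balance `0 ≤ Jq M G q t` at every type `t ≤ q` on every rank-`q` set — gives
`RLS M (q + 2) q`, i.e. `((q + 2)/(q + 1)) · #U(q + 2, q) ≤ #Y(q + 2, q)`.  The hard max-trace rule `fHardQ` is the
normalised weighting of `PerFlat.c025_of_perFlat_normalized` and `perFlat_of_Jq_nonneg` is its per-flat inequality;
at `q = 4` this is `rls_six_four_of_perSolid` on the core. -/
theorem rls_succ_succ_of_perFlatAll {α : Type} [DecidableEq α] (q : ℕ) (hall : PerFlatAll q)
    (M : Matroid α) [M.Finite] (hs : Simple M) (hge : ((q + 2 : ℕ) : ℕ∞) ≤ M.eRank) :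
    RLS M (q + 2) q := by
  unfold RLS
  rw [phiK_succ_succ]
  apply PerFlat.c025_of_perFlat_normalized M (q + 2) q (by positivity) (fHardQ M q)
    (fun P S => fHardQ_nonneg q P S)
  intro G hG
  have hGg : G ⊆ gr M := (mem_flatsQ.1 hG).1
  have hr : M.eRk (G : Set α) = (q : ℕ∞) := (mem_flatsQ.1 hG).2.2
  exact perFlat_of_Jq_nonneg hG (hall M G hs hGg hr _ (typeOfQ_le_q hG hge))

/-- **The core of the `(q + 2, q)` row from the balance on the family `𝔉`** (`PerFlatResidue q`). -/
theorem rls_succ_succ_of_residue {α : Type} [DecidableEq α] (q : ℕ) (hres : PerFlatResidue q)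
    (M : Matroid α) [M.Finite] (hs : Simple M) (hge : ((q + 2 : ℕ) : ℕ∞) ≤ M.eRank) :
    RLS M (q + 2) q :=
  rls_succ_succ_of_perFlatAll q (perFlatAll_of_residue hres) M hs hge

end PercRepro.GenQ
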